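import Literature.Analysis.FluidPDE.FluidComputer.CircuitArchitecture
import Literature.Analysis.FluidPDE.TaoCascadeWaveletFourier
import HarnessLib

/-!
# Fourier-block design, I: the scale-homogeneous weighted junk seminorm

HONEST FRAMING (cell `pub-fluidc`, verbatim): *low prior, high value-of-information experiment on
Tao's machine paradigm; NOT a claim that NS blows up.*

Toolkit for the CONCRETE Fourier-block instance of the STATICS of `ShadowedCircuit`
(`Literature/Analysis/FluidPDE/FluidComputer/CircuitArchitecture.lean`), files `BlockReadout`,
`BlockHandoff`, `BlockStatics`. The junk functional of that instance is an infimum of the weighted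
Fourier seminorm

  `J_{μ,κ,s}(z) = (∫ (w_{μ,κ,s}(ξ) |ẑ(ξ)|)² dξ)^{1/2}`, `w_{μ,κ,s}(ξ) = (max(|ξ|, μ) / κ)^s`,

the HOMOGENEOUS scale-adapted Sobolev weight with an infrared floor `μ` (`weight`, `J`). Proved here:
`J` vanishes at `0`, is absolutely homogeneous and subadditive (`J_zero`, `J_smul`, `J_add_le`,
Minkowski), is dominated by the scale-adapted norm `X^s_κ` of `RobustPumpCascade` when `0 ≤ μ ≤ κ`
(`J_le_scaledSobolevNorm`), and obeys the EXACT dyadic discount `J_{μ,2κ,s} = 2^{-s} J_{μ,κ,s}`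
(`J_two_mul`) — the geometric forgetting of coarse content that `Forgetting.no_faithful_junk` (F2)
shows every junk functional of a shadowed circuit must have. Against Tao's frequency-localised
wavelets `ψ_{i,k}` (`CascadeWaveletData`) two weighted Cauchy–Schwarz bounds: a lower weight bound
`M ≤ W` on the mode's frequency region gives `M · |⟨z, ψ_{i,k}⟩| ≤ (∫ (W|ẑ|)²)^{1/2}`
(`mul_enorm_pairing_le`), an upper bound `W ≤ M'` there gives `(∫ (W|ψ̂_{i,k}|)²)^{1/2} ≤ M'`
(`weighted_wavelet_le`). No statement about the Navier–Stokes PDE is made here.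
-/

noncomputable section

open MeasureTheory Set Filter Topology Metric
open scoped ENNReal NNReal SchwartzMap

namespace Summit.NavierStokesRegularity.FluidComputer

open Literature.Analysis.FluidPDE.Tao2016
open Literature.Analysis.FluidPDE.FluidComputer

namespace BlockDesign

/-! ### §1. Square-integral functionals with exponent written as a real power -/

/-- `(∫ (c f)²)^{1/2} = c (∫ f²)^{1/2}` for a finite constant `c`. [folklore] -/
theorem lintegral_half_const_mul {α : Type*} [MeasurableSpace α] (ν : Measure α) {c : ℝ≥0∞}
    (hc : c ≠ ⊤) (f : α → ℝ≥0∞) :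
    (∫⁻ x, (c * f x) ^ (2 : ℝ) ∂ν) ^ (1 / 2 : ℝ) = c * (∫⁻ x, f x ^ (2 : ℝ) ∂ν) ^ (1 / 2 : ℝ) := by
  simp_rw [ENNReal.mul_rpow_of_nonneg _ _ (by norm_num : (0 : ℝ) ≤ 2)]
  rw [lintegral_const_mul' _ _ (ENNReal.rpow_ne_top_of_nonneg (by norm_num) hc),
    ENNReal.mul_rpow_of_nonneg _ _ (by norm_num : (0 : ℝ) ≤ 1 / 2), ← ENNReal.rpow_mul]
  norm_num

/-- Monotonicity of `f ↦ (∫ f²)^{1/2}` under an a.e. pointwise bound. [folklore] -/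
theorem lintegral_half_mono_ae {α : Type*} [MeasurableSpace α] {ν : Measure α} {f g : α → ℝ≥0∞}
    (h : ∀ᵐ x ∂ν, f x ≤ g x) :
    (∫⁻ x, f x ^ (2 : ℝ) ∂ν) ^ (1 / 2 : ℝ) ≤ (∫⁻ x, g x ^ (2 : ℝ) ∂ν) ^ (1 / 2 : ℝ) := by
  refine ENNReal.rpow_le_rpow (lintegral_mono_ae ?_) (by norm_num)
  filter_upwards [h] with x hx
  exact ENNReal.rpow_le_rpow hx (by norm_num)

/-! ### §2. The weight and the functional -/

/-- The junk weight `w_{μ,κ,s}(ξ) = (max(|ξ|, μ)/κ)^s`: homogeneous of degree `s` in the frequency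
measured in units of `κ`, floored at the infrared frequency `μ`. [folklore] -/
def weight (μ κ s : ℝ) (ξ : EuclideanSpace ℝ (Fin 3)) : ℝ≥0∞ :=
  ENNReal.ofReal ((max ‖ξ‖ μ / κ) ^ s)

/-- The weight is measurable. [folklore] -/
theorem measurable_weight (μ κ s : ℝ) : Measurable (weight μ κ s) := by
  unfold weight
  exact ENNReal.measurable_ofReal.comp
    (((measurable_norm.max measurable_const).div_const κ).pow_const s)

/-- **Exact dyadic discount of the weight**: `w_{μ,2κ,s} = 2^{-s} w_{μ,κ,s}`. [folklore] -/
theorem weight_two_mul (μ : ℝ) {κ : ℝ} (hκ : 0 < κ) (s : ℝ) (ξ : EuclideanSpace ℝ (Fin 3)) :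
    weight μ (2 * κ) s ξ = ENNReal.ofReal ((1 / 2 : ℝ) ^ s) * weight μ κ s ξ := by
  unfold weight
  have hm : 0 ≤ max ‖ξ‖ μ / κ := div_nonneg ((norm_nonneg ξ).trans (le_max_left _ _)) hκ.le
  rw [← ENNReal.ofReal_mul (Real.rpow_nonneg (by norm_num) s), ← Real.mul_rpow (by norm_num) hm]
  congr 2
  field_simp

/-- The weighted Fourier seminorm `J_{μ,κ,s}(z) = (∫ (w_{μ,κ,s}(ξ) |ẑ(ξ)|)² dξ)^{1/2}`. [folklore] -/
def J (μ κ s : ℝ) (z : L2C) : ℝ≥0∞ :=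
  (∫⁻ ξ, (weight μ κ s ξ * ‖fourierFn z ξ‖ₑ) ^ (2 : ℝ)) ^ (1 / 2 : ℝ)

/-- The pointwise `ℝ≥0∞`-norm of the Fourier transform of an `L²` field is a.e.-measurable. [folklore] -/
theorem aemeasurable_enorm_fourierFn (z : L2C) :
    AEMeasurable (fun ξ => ‖fourierFn z ξ‖ₑ) volume :=
  (Lp.aestronglyMeasurable _).aemeasurable.enorm

/-- `J` only depends on the Fourier transform a.e. [folklore] -/
theorem J_congr_ae {μ κ s : ℝ} {z : L2C} {F : EuclideanSpace ℝ (Fin 3) → EuclideanSpace ℂ (Fin 3)}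
    (h : fourierFn z =ᵐ[volume] F) :
    J μ κ s z = (∫⁻ ξ, (weight μ κ s ξ * ‖F ξ‖ₑ) ^ (2 : ℝ)) ^ (1 / 2 : ℝ) := by
  unfold J
  congr 1
  refine lintegral_congr_ae ?_
  filter_upwards [h] with ξ hξ
  rw [hξ]

/-- **Absolute homogeneity**: `J(c z) = |c| J(z)`. [folklore] -/
theorem J_smul (μ κ s : ℝ) (c : ℂ) (z : L2C) : J μ κ s (c • z) = ‖c‖ₑ * J μ κ s z := by
  rw [J_congr_ae (fourierFn_smul c z), J, ← lintegral_half_const_mul _ enorm_ne_top]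
  congr 1
  refine lintegral_congr fun ξ => ?_
  rw [enorm_smul]
  ring_nf

/-- `J(0) = 0`. [folklore] -/
theorem J_zero (μ κ s : ℝ) : J μ κ s 0 = 0 := by
  have h := J_smul μ κ s 0 0
  rwa [zero_smul, enorm_zero, zero_mul] at h

/-- **Subadditivity** (Minkowski): `J(z₁ + z₂) ≤ J(z₁) + J(z₂)`. [folklore] -/
theorem J_add_le (μ κ s : ℝ) (z₁ z₂ : L2C) : J μ κ s (z₁ + z₂) ≤ J μ κ s z₁ + J μ κ s z₂ := by
  rw [J_congr_ae (fourierFn_add z₁ z₂)]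
  have hw := (measurable_weight μ κ s).aemeasurable (μ := (volume : Measure (EuclideanSpace ℝ (Fin 3))))
  calc (∫⁻ ξ, (weight μ κ s ξ * ‖fourierFn z₁ ξ + fourierFn z₂ ξ‖ₑ) ^ (2 : ℝ)) ^ (1 / 2 : ℝ)
      ≤ (∫⁻ ξ, ((fun ξ => weight μ κ s ξ * ‖fourierFn z₁ ξ‖ₑ) +
          (fun ξ => weight μ κ s ξ * ‖fourierFn z₂ ξ‖ₑ)) ξ ^ (2 : ℝ)) ^ (1 / 2 : ℝ) := by
        refine lintegral_half_mono_ae (Eventually.of_forall fun ξ => ?_)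
        simp only [Pi.add_apply, ← mul_add]
        gcongr
        exact enorm_add_le _ _
    _ ≤ J μ κ s z₁ + J μ κ s z₂ :=
        ENNReal.lintegral_Lp_add_le (hw.mul (aemeasurable_enorm_fourierFn z₁))
          (hw.mul (aemeasurable_enorm_fourierFn z₂)) (by norm_num : (1 : ℝ) ≤ 2)

/-- `J(z₁ - z₂) = J(z₂ - z₁)`. [folklore] -/
theorem J_sub_comm (μ κ s : ℝ) (z₁ z₂ : L2C) : J μ κ s (z₁ - z₂) = J μ κ s (z₂ - z₁) := by
  rw [← neg_sub, ← neg_one_smul ℂ (z₂ - z₁), J_smul]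
  simp

/-- Triangle inequality in difference form: `J(a - c) ≤ J(a - b) + J(b - c)`. [folklore] -/
theorem J_sub_le (μ κ s : ℝ) (a b c : L2C) :
    J μ κ s (a - c) ≤ J μ κ s (a - b) + J μ κ s (b - c) := by
  have h := J_add_le μ κ s (a - b) (b - c)
  rwa [sub_add_sub_cancel] at h

/-- **Exact dyadic discount**: `J_{μ,2κ,s}(z) = 2^{-s} J_{μ,κ,s}(z)`. [folklore] -/
theorem J_two_mul (μ : ℝ) {κ : ℝ} (hκ : 0 < κ) (s : ℝ) (z : L2C) :
    J μ (2 * κ) s z = ENNReal.ofReal ((1 / 2 : ℝ) ^ s) * J μ κ s z := by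
  rw [J, J, ← lintegral_half_const_mul _ ENNReal.ofReal_ne_top]
  congr 1
  refine lintegral_congr fun ξ => ?_
  rw [weight_two_mul μ hκ s ξ, mul_assoc]

/-- **Domination by the scale-adapted Sobolev norm**: for `0 ≤ μ ≤ κ` and `s ≥ 0`,
`J_{μ,κ,s}(z) ≤ ‖z‖_{X^s_κ}` (pointwise `max(|ξ|,μ)² ≤ κ² + |ξ|²`). [folklore] -/
theorem J_le_scaledSobolevNorm {μ κ s : ℝ} (hμ : 0 ≤ μ) (hμκ : μ ≤ κ) (hs : 0 ≤ s) (z : L2C) :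
    J μ κ s z ≤ scaledSobolevNorm s κ z := by
  have hκ : 0 ≤ κ := hμ.trans hμκ
  unfold J scaledSobolevNorm
  refine ENNReal.rpow_le_rpow (lintegral_mono fun ξ => ?_) (by norm_num)
  rw [ENNReal.mul_rpow_of_nonneg _ _ (by norm_num : (0 : ℝ) ≤ 2), ENNReal.rpow_two, ENNReal.rpow_two]
  refine mul_le_mul' ?_ le_rfl
  unfold weight
  have hm : 0 ≤ max ‖ξ‖ μ / κ := div_nonneg ((norm_nonneg ξ).trans (le_max_left _ _)) hκ
  rw [← ENNReal.ofReal_pow (Real.rpow_nonneg hm s), ← Real.rpow_natCast,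
    ← Real.rpow_mul hm, mul_comm s, Real.rpow_mul hm, Real.rpow_natCast]
  refine ENNReal.ofReal_le_ofReal (Real.rpow_le_rpow (sq_nonneg _) ?_ hs)
  rcases eq_or_lt_of_le hκ with hκ0 | hκpos
  · rw [← hκ0]
    have : μ = 0 := le_antisymm (hκ0 ▸ hμκ) hμ
    simp [this]
  · rw [div_pow, div_le_iff₀ (pow_pos hκpos 2), add_mul, one_mul, div_mul_cancel₀ _ (pow_pos hκpos 2).ne']
    have h1 : max ‖ξ‖ μ ^ 2 ≤ ‖ξ‖ ^ 2 + μ ^ 2 := by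
      rcases le_total ‖ξ‖ μ with h | h
      · rw [max_eq_right h]; nlinarith [norm_nonneg ξ]
      · rw [max_eq_left h]; nlinarith
    nlinarith [mul_self_le_mul_self hμ hμκ]

/-! ### §3. Weighted Cauchy–Schwarz against Tao's frequency-localised wavelets -/

section Wavelet

variable {ε₀ : ℝ} {m : ℕ} (𝒟 : CascadeWaveletData ε₀ m)

/-- **Lower weight bound on the mode's region ⇒ coefficient bound**: if `M ≤ W` on the frequency
region of `ψ_{i,k}` then `M · |⟨z, ψ_{i,k}⟩| ≤ (∫ (W |ẑ|)²)^{1/2}` (Parseval, `ψ̂_{i,k}` vanishes off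
its region and has unit mass, Cauchy–Schwarz). [cite: Tao2016AveragedNS, §4 (4.6)] -/
theorem mul_enorm_pairing_le (hε : 0 < 1 + ε₀) (i : Fin m) (k : ℤ)
    {W : EuclideanSpace ℝ (Fin 3) → ℝ≥0∞} (hW : Measurable W) {M : ℝ≥0∞} (hM : M ≠ ⊤)
    (hMW : ∀ ξ ∈ freqRegion 𝒟 i k, M ≤ W ξ) (z : L2C) :
    M * ‖pairing z (cascadeWavelet ε₀ (𝒟.ψ i) k)‖ₑ ≤
      (∫⁻ ξ, (W ξ * ‖fourierFn z ξ‖ₑ) ^ (2 : ℝ)) ^ (1 / 2 : ℝ) := by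
  set ψk := cascadeWavelet ε₀ (𝒟.ψ i) k with hψk
  rw [pairing_eq_integral_fourierFn (isReal_cascadeWavelet ε₀ (𝒟.ψ i) k)]
  have hpt : ∀ᵐ ξ ∂(volume : Measure (EuclideanSpace ℝ (Fin 3))),
      M * ‖inner ℂ (fourierFn ψk ξ) (fourierFn z ξ)‖ₑ ≤
        ‖fourierFn ψk ξ‖ₑ * (W ξ * ‖fourierFn z ξ‖ₑ) := by
    filter_upwards [𝒟.fourierFn_cascadeWavelet_eq_zero hε i k] with ξ h0
    by_cases hin : ξ ∈ freqRegion 𝒟 i k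
    · calc M * ‖inner ℂ (fourierFn ψk ξ) (fourierFn z ξ)‖ₑ
          ≤ W ξ * (‖fourierFn ψk ξ‖ₑ * ‖fourierFn z ξ‖ₑ) := by
            refine mul_le_mul' (hMW ξ hin) ?_
            rw [← ofReal_norm, ← ofReal_norm, ← ofReal_norm, ← ENNReal.ofReal_mul (norm_nonneg _)]
            exact ENNReal.ofReal_le_ofReal (norm_inner_le_norm _ _)
        _ = ‖fourierFn ψk ξ‖ₑ * (W ξ * ‖fourierFn z ξ‖ₑ) := by ring
    · rw [hψk, h0 hin, inner_zero_left, enorm_zero, mul_zero]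
      exact zero_le
  calc M * ‖∫ ξ, inner ℂ (fourierFn ψk ξ) (fourierFn z ξ)‖ₑ
      ≤ M * ∫⁻ ξ, ‖inner ℂ (fourierFn ψk ξ) (fourierFn z ξ)‖ₑ := by
        gcongr
        exact enorm_integral_le_lintegral_enorm _
    _ = ∫⁻ ξ, M * ‖inner ℂ (fourierFn ψk ξ) (fourierFn z ξ)‖ₑ := (lintegral_const_mul' _ _ hM).symm
    _ ≤ ∫⁻ ξ, ((fun ξ => ‖fourierFn ψk ξ‖ₑ) * fun ξ => W ξ * ‖fourierFn z ξ‖ₑ) ξ :=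
        lintegral_mono_ae (by simpa only [Pi.mul_apply] using hpt)
    _ ≤ (∫⁻ ξ, ‖fourierFn ψk ξ‖ₑ ^ (2 : ℝ)) ^ (1 / (2 : ℝ)) *
          (∫⁻ ξ, (W ξ * ‖fourierFn z ξ‖ₑ) ^ (2 : ℝ)) ^ (1 / (2 : ℝ)) :=
        ENNReal.lintegral_mul_le_Lp_mul_Lq volume Real.HolderConjugate.two_two
          (aemeasurable_enorm_fourierFn ψk) (hW.aemeasurable.mul (aemeasurable_enorm_fourierFn z))
    _ = (∫⁻ ξ, (W ξ * ‖fourierFn z ξ‖ₑ) ^ (2 : ℝ)) ^ (1 / 2 : ℝ) := by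
        rw [hψk, 𝒟.lintegral_fourierFn_cascadeWavelet hε i k, one_mul]

/-- **Upper weight bound on the mode's region ⇒ weighted size of the mode**: if `W ≤ M'` on the
frequency region of `ψ_{i,k}` then `(∫ (W |ψ̂_{i,k}|)²)^{1/2} ≤ M'`. [cite: Tao2016AveragedNS, §4 p. 21] -/
theorem weighted_wavelet_le (hε : 0 < 1 + ε₀) (i : Fin m) (k : ℤ)
    {W : EuclideanSpace ℝ (Fin 3) → ℝ≥0∞} {M' : ℝ≥0∞} (hMW : ∀ ξ ∈ freqRegion 𝒟 i k, W ξ ≤ M') :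
    (∫⁻ ξ, (W ξ * ‖fourierFn (cascadeWavelet ε₀ (𝒟.ψ i) k) ξ‖ₑ) ^ (2 : ℝ)) ^ (1 / 2 : ℝ) ≤ M' := by
  rcases eq_or_ne M' ⊤ with hM | hM
  · rw [hM]; exact le_top
  set ψk := cascadeWavelet ε₀ (𝒟.ψ i) k with hψk
  calc (∫⁻ ξ, (W ξ * ‖fourierFn ψk ξ‖ₑ) ^ (2 : ℝ)) ^ (1 / 2 : ℝ)
      ≤ (∫⁻ ξ, (M' * ‖fourierFn ψk ξ‖ₑ) ^ (2 : ℝ)) ^ (1 / 2 : ℝ) := by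
        refine lintegral_half_mono_ae ?_
        filter_upwards [𝒟.fourierFn_cascadeWavelet_eq_zero hε i k] with ξ h0
        by_cases hin : ξ ∈ freqRegion 𝒟 i k
        · exact mul_le_mul' (hMW ξ hin) le_rfl
        · rw [hψk, h0 hin, enorm_zero, mul_zero, mul_zero]
    _ = M' * (∫⁻ ξ, ‖fourierFn ψk ξ‖ₑ ^ (2 : ℝ)) ^ (1 / 2 : ℝ) := lintegral_half_const_mul _ hM _
    _ = M' := by rw [hψk, 𝒟.lintegral_fourierFn_cascadeWavelet hε i k, mul_one]

/-- Specialisation to the junk weight: a lower bound `M ≤ w_{μ,κ,s}` on the region of `ψ_{i,k}`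
gives `M |⟨z, ψ_{i,k}⟩| ≤ J_{μ,κ,s}(z)`. [folklore] -/
theorem mul_enorm_pairing_le_J (hε : 0 < 1 + ε₀) (i : Fin m) (k : ℤ) {μ κ s : ℝ} {M : ℝ}
    (hMW : ∀ ξ ∈ freqRegion 𝒟 i k, M ≤ (max ‖ξ‖ μ / κ) ^ s) (z : L2C) :
    ENNReal.ofReal M * ‖pairing z (cascadeWavelet ε₀ (𝒟.ψ i) k)‖ₑ ≤ J μ κ s z :=
  mul_enorm_pairing_le 𝒟 hε i k (measurable_weight μ κ s) ENNReal.ofReal_ne_top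
    (fun ξ hξ => ENNReal.ofReal_le_ofReal (hMW ξ hξ)) z

/-- Specialisation to the junk weight: an upper bound `w_{μ,κ,s} ≤ M'` on the region of `ψ_{i,k}`
gives `J_{μ,κ,s}(c ψ_{i,k}) ≤ |c| M'`. [folklore] -/
theorem J_smul_wavelet_le (hε : 0 < 1 + ε₀) (i : Fin m) (k : ℤ) {μ κ s : ℝ} {M' : ℝ}
    (hMW : ∀ ξ ∈ freqRegion 𝒟 i k, (max ‖ξ‖ μ / κ) ^ s ≤ M') (c : ℂ) :
    J μ κ s (c • cascadeWavelet ε₀ (𝒟.ψ i) k) ≤ ‖c‖ₑ * ENNReal.ofReal M' := by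
  rw [J_smul]
  gcongr
  exact weighted_wavelet_le 𝒟 hε i k fun ξ hξ => ENNReal.ofReal_le_ofReal (hMW ξ hξ)

end Wavelet

end BlockDesign

end Summit.NavierStokesRegularity.FluidComputer

end
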